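import Summits.Ventures.PercRepro.Night2ExcessMass

/-!
# PercRepro — the `(7, 5)` cell `(3, 2)` in the per-basis excess regime with `m₁ = 3` (night-2, gen 20)

`Night2PartialCells` closed the cell `(3, 2)` when every non-basis thin member misses `≥ 5` points (`m₁ = 5`).
With the per-basis excess bound the target sum `genSum n 4 3 c′ (E/4) ≥ 1` holds with `m₁ = 3` at every
`7 ≤ n = |G| − 2 ≤ 13` (`excessBound = 9/20 … 67/220`, chord of `1/(m + 3)` over `2 ≤ m ≤ n − 3`), and the crude
bound `ρ λ = 31/60` already suffices with `m₁ = 3` for `n ≥ 14` (`93 C(n, 4) ≤ 5 A + 180 T`: `14 ≤ n ≤ 25` by kernel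
evaluation, `n ≥ 26` from `93 C(n, 4) ≤ 5 (C(n, 5) + C(n, 6))`).
**`localShadowHall_three_two_five_of_excess`**: (LI_G) at the cell whenever every thin member with `|B ∖ K| ≥ 4`
misses at least `3` points (no size bound).
-/

namespace PercRepro.Shadow

open Finset PerFlat ThmH

namespace DGenP

/-- The chord of `1/(m + 3)` over `2 ≤ m ≤ 4` (cell `(3, 2)`, `n = 7`). -/
theorem chord_three_two_7 : ∀ m : ℕ, 2 ≤ m → m ≤ 4 →
    1 / ((m : ℚ) + ((3 : ℕ) : ℚ)) ≤ (9 / 35 : ℚ) - (1 / 35 : ℚ) * (m : ℚ) := by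
  intro m h1 h2
  interval_cases m <;> norm_num

/-- `excessBound = 9/20` at `(3, 2)`, `n = 7`. -/
theorem excessBound_three_two_7 : excessBound 5 3 4 2 7 (9 / 35 : ℚ) (1 / 35 : ℚ) = (9 / 20 : ℚ) := by
  unfold excessBound capDG phiQ; norm_num

/-- The target sum of the cell `(3, 2)` at `n = 7` with `m₁ = 3`: `9/20 · C(7, 4) ≤ c′ A + T` with `A = 0`, `T = 29`. -/
theorem sum_three_two_7_m3 : 1 ≤ DGenP.genSum 7 4 3 (cPrimeDGP 5 3 4 2 3)
    (excessBound 5 3 4 2 7 (9 / 35 : ℚ) (1 / 35 : ℚ) / ((4 : ℕ) : ℚ)) := by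
  have hc : cPrimeDGP 5 3 4 2 3 = (1 / 36 : ℚ) := by unfold cPrimeDGP capDG reqDGP phiQ; norm_num
  have hA : DGen.Aρt 7 4 3 = 0 := by decide
  have hT : DGen.Ttop 7 3 = 29 := by decide
  have hC : Nat.choose 7 4 = 35 := by decide
  rw [excessBound_three_two_7, hc, DGenP.genSum_eq (by norm_num) (by norm_num) (by norm_num), hA, hT, hC]
  norm_num

/-- The chord of `1/(m + 3)` over `2 ≤ m ≤ 5` (cell `(3, 2)`, `n = 8`). -/
theorem chord_three_two_8 : ∀ m : ℕ, 2 ≤ m → m ≤ 5 →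
    1 / ((m : ℚ) + ((3 : ℕ) : ℚ)) ≤ (1 / 4 : ℚ) - (1 / 40 : ℚ) * (m : ℚ) := by
  intro m h1 h2
  interval_cases m <;> norm_num

/-- `excessBound = 2/5` at `(3, 2)`, `n = 8`. -/
theorem excessBound_three_two_8 : excessBound 5 3 4 2 8 (1 / 4 : ℚ) (1 / 40 : ℚ) = (2 / 5 : ℚ) := by
  unfold excessBound capDG phiQ; norm_num

/-- The target sum of the cell `(3, 2)` at `n = 8` with `m₁ = 3`: `2/5 · C(8, 4) ≤ c′ A + T` with `A = 56`, `T = 37`. -/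
theorem sum_three_two_8_m3 : 1 ≤ DGenP.genSum 8 4 3 (cPrimeDGP 5 3 4 2 3)
    (excessBound 5 3 4 2 8 (1 / 4 : ℚ) (1 / 40 : ℚ) / ((4 : ℕ) : ℚ)) := by
  have hc : cPrimeDGP 5 3 4 2 3 = (1 / 36 : ℚ) := by unfold cPrimeDGP capDG reqDGP phiQ; norm_num
  have hA : DGen.Aρt 8 4 3 = 56 := by decide
  have hT : DGen.Ttop 8 3 = 37 := by decide
  have hC : Nat.choose 8 4 = 70 := by decide
  rw [excessBound_three_two_8, hc, DGenP.genSum_eq (by norm_num) (by norm_num) (by norm_num), hA, hT, hC]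
  norm_num

/-- The chord of `1/(m + 3)` over `2 ≤ m ≤ 6` (cell `(3, 2)`, `n = 9`). -/
theorem chord_three_two_9 : ∀ m : ℕ, 2 ≤ m → m ≤ 6 →
    1 / ((m : ℚ) + ((3 : ℕ) : ℚ)) ≤ (11 / 45 : ℚ) - (1 / 45 : ℚ) * (m : ℚ) := by
  intro m h1 h2
  interval_cases m <;> norm_num

/-- `excessBound = 13/36` at `(3, 2)`, `n = 9`. -/
theorem excessBound_three_two_9 : excessBound 5 3 4 2 9 (11 / 45 : ℚ) (1 / 45 : ℚ) = (13 / 36 : ℚ) := by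
  unfold excessBound capDG phiQ; norm_num

/-- The target sum of the cell `(3, 2)` at `n = 9` with `m₁ = 3`: `13/36 · C(9, 4) ≤ c′ A + T` with `A = 210`, `T = 46`. -/
theorem sum_three_two_9_m3 : 1 ≤ DGenP.genSum 9 4 3 (cPrimeDGP 5 3 4 2 3)
    (excessBound 5 3 4 2 9 (11 / 45 : ℚ) (1 / 45 : ℚ) / ((4 : ℕ) : ℚ)) := by
  have hc : cPrimeDGP 5 3 4 2 3 = (1 / 36 : ℚ) := by unfold cPrimeDGP capDG reqDGP phiQ; norm_num
  have hA : DGen.Aρt 9 4 3 = 210 := by decide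
  have hT : DGen.Ttop 9 3 = 46 := by decide
  have hC : Nat.choose 9 4 = 126 := by decide
  rw [excessBound_three_two_9, hc, DGenP.genSum_eq (by norm_num) (by norm_num) (by norm_num), hA, hT, hC]
  norm_num

/-- The chord of `1/(m + 3)` over `2 ≤ m ≤ 7` (cell `(3, 2)`, `n = 10`). -/
theorem chord_three_two_10 : ∀ m : ℕ, 2 ≤ m → m ≤ 7 →
    1 / ((m : ℚ) + ((3 : ℕ) : ℚ)) ≤ (6 / 25 : ℚ) - (1 / 50 : ℚ) * (m : ℚ) := by
  intro m h1 h2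
  interval_cases m <;> norm_num

/-- `excessBound = 33/100` at `(3, 2)`, `n = 10`. -/
theorem excessBound_three_two_10 : excessBound 5 3 4 2 10 (6 / 25 : ℚ) (1 / 50 : ℚ) = (33 / 100 : ℚ) := by
  unfold excessBound capDG phiQ; norm_num

/-- The target sum of the cell `(3, 2)` at `n = 10` with `m₁ = 3`: `33/100 · C(10, 4) ≤ c′ A + T` with `A = 582`, `T = 56`. -/
theorem sum_three_two_10_m3 : 1 ≤ DGenP.genSum 10 4 3 (cPrimeDGP 5 3 4 2 3)
    (excessBound 5 3 4 2 10 (6 / 25 : ℚ) (1 / 50 : ℚ) / ((4 : ℕ) : ℚ)) := by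
  have hc : cPrimeDGP 5 3 4 2 3 = (1 / 36 : ℚ) := by unfold cPrimeDGP capDG reqDGP phiQ; norm_num
  have hA : DGen.Aρt 10 4 3 = 582 := by decide
  have hT : DGen.Ttop 10 3 = 56 := by decide
  have hC : Nat.choose 10 4 = 210 := by decide
  rw [excessBound_three_two_10, hc, DGenP.genSum_eq (by norm_num) (by norm_num) (by norm_num), hA, hT, hC]
  norm_num

/-- The chord of `1/(m + 3)` over `2 ≤ m ≤ 8` (cell `(3, 2)`, `n = 11`). -/
theorem chord_three_two_11 : ∀ m : ℕ, 2 ≤ m → m ≤ 8 →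
    1 / ((m : ℚ) + ((3 : ℕ) : ℚ)) ≤ (13 / 55 : ℚ) - (1 / 55 : ℚ) * (m : ℚ) := by
  intro m h1 h2
  interval_cases m <;> norm_num

/-- `excessBound = 67/220` at `(3, 2)`, `n = 11`. -/
theorem excessBound_three_two_11 : excessBound 5 3 4 2 11 (13 / 55 : ℚ) (1 / 55 : ℚ) = (67 / 220 : ℚ) := by
  unfold excessBound capDG phiQ; norm_num

/-- The target sum of the cell `(3, 2)` at `n = 11` with `m₁ = 3`: `67/220 · C(11, 4) ≤ c′ A + T` with `A = 1419`, `T = 67`. -/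
theorem sum_three_two_11_m3 : 1 ≤ DGenP.genSum 11 4 3 (cPrimeDGP 5 3 4 2 3)
    (excessBound 5 3 4 2 11 (13 / 55 : ℚ) (1 / 55 : ℚ) / ((4 : ℕ) : ℚ)) := by
  have hc : cPrimeDGP 5 3 4 2 3 = (1 / 36 : ℚ) := by unfold cPrimeDGP capDG reqDGP phiQ; norm_num
  have hA : DGen.Aρt 11 4 3 = 1419 := by decide
  have hT : DGen.Ttop 11 3 = 67 := by decide
  have hC : Nat.choose 11 4 = 330 := by decide
  rw [excessBound_three_two_11, hc, DGenP.genSum_eq (by norm_num) (by norm_num) (by norm_num), hA, hT, hC]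
  norm_num

/-- The chord of `1/(m + 3)` over `2 ≤ m ≤ 9` (cell `(3, 2)`, `n = 12`). -/
theorem chord_three_two_12 : ∀ m : ℕ, 2 ≤ m → m ≤ 9 →
    1 / ((m : ℚ) + ((3 : ℕ) : ℚ)) ≤ (7 / 30 : ℚ) - (1 / 60 : ℚ) * (m : ℚ) := by
  intro m h1 h2
  interval_cases m <;> norm_num

/-- `excessBound = 17/60` at `(3, 2)`, `n = 12`. -/
theorem excessBound_three_two_12 : excessBound 5 3 4 2 12 (7 / 30 : ℚ) (1 / 60 : ℚ) = (17 / 60 : ℚ) := by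
  unfold excessBound capDG phiQ; norm_num

/-- The target sum of the cell `(3, 2)` at `n = 12` with `m₁ = 3`: `17/60 · C(12, 4) ≤ c′ A + T` with `A = 3223`, `T = 79`. -/
theorem sum_three_two_12_m3 : 1 ≤ DGenP.genSum 12 4 3 (cPrimeDGP 5 3 4 2 3)
    (excessBound 5 3 4 2 12 (7 / 30 : ℚ) (1 / 60 : ℚ) / ((4 : ℕ) : ℚ)) := by
  have hc : cPrimeDGP 5 3 4 2 3 = (1 / 36 : ℚ) := by unfold cPrimeDGP capDG reqDGP phiQ; norm_num
  have hA : DGen.Aρt 12 4 3 = 3223 := by decide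
  have hT : DGen.Ttop 12 3 = 79 := by decide
  have hC : Nat.choose 12 4 = 495 := by decide
  rw [excessBound_three_two_12, hc, DGenP.genSum_eq (by norm_num) (by norm_num) (by norm_num), hA, hT, hC]
  norm_num

/-- The chord of `1/(m + 3)` over `2 ≤ m ≤ 10` (cell `(3, 2)`, `n = 13`). -/
theorem chord_three_two_13 : ∀ m : ℕ, 2 ≤ m → m ≤ 10 →
    1 / ((m : ℚ) + ((3 : ℕ) : ℚ)) ≤ (3 / 13 : ℚ) - (1 / 65 : ℚ) * (m : ℚ) := by
  intro m h1 h2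
  interval_cases m <;> norm_num

/-- `excessBound = 69/260` at `(3, 2)`, `n = 13`. -/
theorem excessBound_three_two_13 : excessBound 5 3 4 2 13 (3 / 13 : ℚ) (1 / 65 : ℚ) = (69 / 260 : ℚ) := by
  unfold excessBound capDG phiQ; norm_num

/-- The target sum of the cell `(3, 2)` at `n = 13` with `m₁ = 3`: `69/260 · C(13, 4) ≤ c′ A + T` with `A = 7007`, `T = 92`. -/
theorem sum_three_two_13_m3 : 1 ≤ DGenP.genSum 13 4 3 (cPrimeDGP 5 3 4 2 3)
    (excessBound 5 3 4 2 13 (3 / 13 : ℚ) (1 / 65 : ℚ) / ((4 : ℕ) : ℚ)) := by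
  have hc : cPrimeDGP 5 3 4 2 3 = (1 / 36 : ℚ) := by unfold cPrimeDGP capDG reqDGP phiQ; norm_num
  have hA : DGen.Aρt 13 4 3 = 7007 := by decide
  have hT : DGen.Ttop 13 3 = 92 := by decide
  have hC : Nat.choose 13 4 = 715 := by decide
  rw [excessBound_three_two_13, hc, DGenP.genSum_eq (by norm_num) (by norm_num) (by norm_num), hA, hT, hC]
  norm_num

/-- `c′ = 1/36` at `(q, d, ρ, k, m₁) = (5, 3, 4, 2, 3)`. -/
theorem cPrimeDGP_three_two_m3 : cPrimeDGP 5 3 4 2 3 = 1 / 36 := by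
  unfold cPrimeDGP capDG reqDGP phiQ; norm_num

/-- `5 (C(n, 5) + C(n, 6)) ≥ 93 C(n, 4)` for `n ≥ 26`. -/
theorem three_two_growth_m3 {n : ℕ} (hn : 26 ≤ n) : 93 * n.choose 4 ≤ 5 * (n.choose 5 + n.choose 6) := by
  obtain ⟨m, rfl⟩ : ∃ m, n = m + 26 := ⟨n - 26, by omega⟩
  have h5 := Nat.choose_succ_right_eq (m + 26) 4
  have h6 := Nat.choose_succ_right_eq (m + 26) 5
  rw [show m + 26 - 4 = m + 22 by omega] at h5
  rw [show m + 26 - 5 = m + 21 by omega] at h6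
  have l5 : 22 * (m + 26).choose 4 ≤ 5 * (m + 26).choose 5 := by
    nlinarith [h5, Nat.zero_le ((m + 26).choose 4 * m)]
  have l6 : 21 * (m + 26).choose 5 ≤ 6 * (m + 26).choose 6 := by
    nlinarith [h6, Nat.zero_le ((m + 26).choose 5 * m)]
  omega

/-- The bounded range `14 ≤ n ≤ 25` of the `(3, 2)` inequality with `m₁ = 3`. -/
theorem three_two_ineq_m3_small {n : ℕ} (hn : 14 ≤ n) (hn' : n ≤ 25) :
    93 * n.choose 4 ≤ 5 * DGen.Aρt n 4 3 + 180 * DGen.Ttop n 3 := by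
  have hid : (∑ i ∈ Finset.range 5, n.choose i) + DGen.Aρt n 4 3 + DGen.Ttop n 3 = 2 ^ n :=
    DGen.sum_range_add_Aρt_add_Ttop (by omega)
  have key : 93 * n.choose 4 + 5 * (∑ i ∈ Finset.range 5, n.choose i) ≤ 5 * 2 ^ n + 175 * DGen.Ttop n 3 := by
    unfold DGen.Ttop
    interval_cases n <;> decide
  omega

/-- **The `(3, 2)` inequality with `m₁ = 3`** `93 C(n, 4) ≤ 5 A + 180 T` for every `n ≥ 14`. -/
theorem three_two_ineq_m3 {n : ℕ} (hn : 14 ≤ n) : 93 * n.choose 4 ≤ 5 * DGen.Aρt n 4 3 + 180 * DGen.Ttop n 3 := by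
  by_cases h : n ≤ 25
  · exact three_two_ineq_m3_small hn h
  · push Not at h
    have hA : n.choose 5 + n.choose 6 ≤ DGen.Aρt n 4 3 := DGen.Aρt_ge_two (by omega)
    have h2 := three_two_growth_m3 (by omega : 26 ≤ n)
    omega

/-- The crude target sum of the cell `(3, 2)` with `m₁ = 3` is at least `1` for every `n ≥ 14`. -/
theorem one_le_genSum_three_two_m3 {n : ℕ} (hn : 14 ≤ n) :
    1 ≤ genSum n 4 3 (cPrimeDGP 5 3 4 2 3) (lambdaDG 5 3 4 2) := by
  rw [cPrimeDGP_three_two_m3, lambdaDG_three_two, genSum_eq (by omega) (by norm_num) (by norm_num)]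
  have hC : (0 : ℚ) < (n.choose 4 : ℚ) := by exact_mod_cast Nat.choose_pos (by omega)
  rw [le_div_iff₀ (by positivity)]
  have key' : (93 : ℚ) * (n.choose 4 : ℚ) ≤ 5 * (DGen.Aρt n 4 3 : ℚ) + 180 * (DGen.Ttop n 3 : ℚ) := by
    exact_mod_cast three_two_ineq_m3 hn
  norm_num
  linarith

end DGenP

variable {α : Type*} [DecidableEq α] {M : Matroid α} [M.Finite]

open DGenP in
open scoped Classical in
/-- **THE `(7, 5)` CELL `(3, 2)` IN THE `3`-PARTIAL-SPREAD REGIME**: every thin member with `|B ∖ K| ≥ 4` misses at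
least `3` points of `G` (per-basis excess for `7 ≤ |G| − 2 ≤ 13`, the crude sum beyond). -/
theorem localShadowHall_three_two_five_of_excess {G : Finset α} (hG : G ∈ flatsQ M (5 + 1))
    (hd : (gr M \ G).card = 3) (hk : kColoops M G = 2)
    (hs : ∀ e ∈ gr M, ∀ f ∈ gr M, e ≠ f → rkN M {e, f} = 2) (hl : ∀ e ∈ gr M, M.Indep {e})
    (hm₁ : ∀ B ∈ thinMembers M 5 G, 4 ≤ (B \ coloops M G).card → 3 ≤ (G \ clF M B).card) :
    LocalShadowHall M 5 G := by
  have hk' : kColoops M G + 4 = 5 + 1 := by omega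
  have hc3 : 0 ≤ cPrimeDGP 5 3 4 (kColoops M G) 3 := by rw [hk]; unfold cPrimeDGP capDG reqDGP phiQ; norm_num
  by_cases hn7 : 7 ≤ G.card - kColoops M G
  · by_cases hn13 : G.card - kColoops M G ≤ 13
    · obtain ⟨n, hn⟩ : ∃ n, G.card - kColoops M G = n := ⟨_, rfl⟩
      have hn1' : 7 ≤ n := by omega
      have hn2' : n ≤ 13 := by omega
      interval_cases n
      · exact localShadowHall_excess_of_sum (d := 3) (ρ := 4) (m₁ := 3) hG hd (by norm_num) hk' (by norm_num)
          (by omega) hs hl hc3 hm₁ (a := (9 / 35 : ℚ)) (b := (1 / 35 : ℚ)) (by norm_num)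
          (by rw [hn]; intro m h1 h2; exact chord_three_two_7 m h1 (by omega))
          (by rw [hn, hk, excessBound_three_two_7]; norm_num) (by rw [hn, hk]; exact sum_three_two_7_m3)
      · exact localShadowHall_excess_of_sum (d := 3) (ρ := 4) (m₁ := 3) hG hd (by norm_num) hk' (by norm_num)
          (by omega) hs hl hc3 hm₁ (a := (1 / 4 : ℚ)) (b := (1 / 40 : ℚ)) (by norm_num)
          (by rw [hn]; intro m h1 h2; exact chord_three_two_8 m h1 (by omega))
          (by rw [hn, hk, excessBound_three_two_8]; norm_num) (by rw [hn, hk]; exact sum_three_two_8_m3)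
      · exact localShadowHall_excess_of_sum (d := 3) (ρ := 4) (m₁ := 3) hG hd (by norm_num) hk' (by norm_num)
          (by omega) hs hl hc3 hm₁ (a := (11 / 45 : ℚ)) (b := (1 / 45 : ℚ)) (by norm_num)
          (by rw [hn]; intro m h1 h2; exact chord_three_two_9 m h1 (by omega))
          (by rw [hn, hk, excessBound_three_two_9]; norm_num) (by rw [hn, hk]; exact sum_three_two_9_m3)
      · exact localShadowHall_excess_of_sum (d := 3) (ρ := 4) (m₁ := 3) hG hd (by norm_num) hk' (by norm_num)
          (by omega) hs hl hc3 hm₁ (a := (6 / 25 : ℚ)) (b := (1 / 50 : ℚ)) (by norm_num)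
          (by rw [hn]; intro m h1 h2; exact chord_three_two_10 m h1 (by omega))
          (by rw [hn, hk, excessBound_three_two_10]; norm_num) (by rw [hn, hk]; exact sum_three_two_10_m3)
      · exact localShadowHall_excess_of_sum (d := 3) (ρ := 4) (m₁ := 3) hG hd (by norm_num) hk' (by norm_num)
          (by omega) hs hl hc3 hm₁ (a := (13 / 55 : ℚ)) (b := (1 / 55 : ℚ)) (by norm_num)
          (by rw [hn]; intro m h1 h2; exact chord_three_two_11 m h1 (by omega))
          (by rw [hn, hk, excessBound_three_two_11]; norm_num) (by rw [hn, hk]; exact sum_three_two_11_m3)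
      · exact localShadowHall_excess_of_sum (d := 3) (ρ := 4) (m₁ := 3) hG hd (by norm_num) hk' (by norm_num)
          (by omega) hs hl hc3 hm₁ (a := (7 / 30 : ℚ)) (b := (1 / 60 : ℚ)) (by norm_num)
          (by rw [hn]; intro m h1 h2; exact chord_three_two_12 m h1 (by omega))
          (by rw [hn, hk, excessBound_three_two_12]; norm_num) (by rw [hn, hk]; exact sum_three_two_12_m3)
      · exact localShadowHall_excess_of_sum (d := 3) (ρ := 4) (m₁ := 3) hG hd (by norm_num) hk' (by norm_num)
          (by omega) hs hl hc3 hm₁ (a := (3 / 13 : ℚ)) (b := (1 / 65 : ℚ)) (by norm_num)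
          (by rw [hn]; intro m h1 h2; exact chord_three_two_13 m h1 (by omega))
          (by rw [hn, hk, excessBound_three_two_13]; norm_num) (by rw [hn, hk]; exact sum_three_two_13_m3)
    · push Not at hn13
      exact localShadowHall_dgenP_of_sum (d := 3) (ρ := 4) (m₁ := 3) hG hd (by norm_num) hk'
        (by norm_num) (by omega) hs hl hc3 (by rw [hk, DGenP.lambdaDG_three_two]; norm_num) hm₁
        (by rw [hk] at hn13 ⊢; exact DGenP.one_le_genSum_three_two_m3 (by omega))
  · -- fewer than 7 points off the coloops: there is no thin member at all
    exact localShadowHall_of_spread (ρ := 4) (m₀ := 9) hG hd (by norm_num) (by rw [hk])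
      (fun B hB => absurd (thin_card_bound (ρ := 4) hG hd (by norm_num) (by rw [hk]) hB) (by omega))
      (by rw [hk]; unfold phiQ; norm_num)

end PercRepro.Shadow
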